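/-
Copyright (c) 2026. All rights reserved.
Released under Apache 2.0 license as described in the file LICENSE.
-/
import Mathlib
import HarnessLib
import Literature.MathematicalPhysics.QuantumLattice.GaugeGroups
import Literature.MathematicalPhysics.QuantumFieldTheory.ConstructiveQFTWave0
import Literature.MathematicalPhysics.QuantumFieldTheory.LatticeGaugeProofs
import Literature.MathematicalPhysics.QuantumFieldTheory.U1GinibreComparison
import Literature.MathematicalPhysics.QuantumLattice.AbelianFieldTensor
import Literature.MathematicalPhysics.QuantumLattice.AbelianMagneticFlux
import Summits.Ventures.LatticeQCDFlow.Exactness.SymmetricMetropolis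
import Summits.Ventures.LatticeQCDFlow.Exactness.CompactHaar
import Summits.Ventures.LatticeQCDFlow.Scaling.LatticePeeling
import Summits.Ventures.LatticeQCDFlow.Scaling.SliceTwistWitness
import Summits.Ventures.LatticeQCDFlow.Scaling.FluxTunnellingU1Explicit
import Summits.Ventures.LatticeQCDFlow.Scaling.BoxSpreadWitness
import Summits.Ventures.LatticeQCDFlow.Scaling.BoxTouch
import Summits.Ventures.LatticeQCDFlow.Scaling.FluxTunnellingU1MaxPlaquette
import Summits.Ventures.LatticeQCDFlow.Scaling.FluxInsertionKernel
import Summits.Ventures.LatticeQCDFlow.Scaling.FluxInsertionBox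
import Summits.Ventures.LatticeQCDFlow.Scaling.ConvolutionPowerCompensation
import Summits.Ventures.LatticeQCDFlow.Scaling.FluxInsertionSharpFloor
import Summits.Ventures.LatticeQCDFlow.Scaling.FluxInsertionSharpFloorInstances

/-!
# The sharp tunnelling RATE of the block-insertion kernel (conjecture C9′ typed)

HONEST FRAMING: exact (Metropolis-corrected) sampling algorithms for lattice gauge theory;
figures of merit are autocorrelation/cost numbers at stated couplings and volumes; no
continuum-physics claim.

Venture `LatticeQCDFlow` (cell pub-lqcd), topic `Scaling`, FANOUT row 29 (theory2, gen-20), item 105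
(imports item 104b `Scaling/FluxInsertionSharpFloorInstances` — the sharp floor — and item 97
`Scaling/FluxTunnellingU1MaxPlaquette` — the action-currency ceiling — for gen-19's exact,
block-local block-insertion kernel `K_box = boxInsertionMH β l` of item 100).  NEW WORK; nothing
here is cited as a fact.  `U(1)`, `d = 2`, Wilson action, torus `(ℤ/L)²`, `μ_{β,L} = wilsonMeasure
u1Rep β`, `Q = Flux.topCharge 0 0 1`, `N = (l+1)² − 4 = (l−1)(l+3)`, `θ = α_l/2 = π/N`
(`boxAlpha_half_eq`), `E_N = N(1 − cos(π/N))`, and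
`P_{β,l,L} = boxTunnelProb β l L = (μ_{β,L} ⊗ K_box){Q ≠ Q'}` (the per-step tunnelling probability in
equilibrium, a real number).

The `β → ∞` asymptotics of items 104b (floor; `η = ε/2`, `λ = κη/N`) and 97 (ceiling), in the
`ε`-form of statements about `−(1/β) log P`:
* **`u1_boxInsertion_rate_floor`** (`2 ≤ l`, `l + 1 ≤ L`, any parity, `ε > 0`): eventually in `β`,
  `e^{−β(E_N + (L²−N)(1 − cos(π/(L²−N−1))) + ε)} ≤ P_{β,l,L}`;
* **`u1_boxInsertion_rate_ceiling`** (`L` even in addition): eventually in `β`,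
  `P_{β,l,L} ≤ e^{−β(E_N − ε)}`;
* **`u1_boxInsertion_rate_floor_largeVolume`** (`2 ≤ l`, `ε > 0`): there is `L₀` such that for
  every `L ≥ L₀`, eventually in `β`, `e^{−β(E_N + ε)} ≤ P_{β,l,L}` (the volume term is `≤ π²/(L²−N−1)`);
* **`u1_boxInsertion_sharp_rate`**: for every `ε > 0` there is `L₀` such that for every EVEN
  `L ≥ L₀`, eventually in `β`, `e^{−β(E_N + ε)} ≤ P_{β,l,L} ≤ e^{−β(E_N − ε)}` — i.e.
  `lim_{L → ∞, L even} lim_{β → ∞} −(1/β) log P_{β,l,L} = N(1 − cos(π/N))`: the necessity rate of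
  item 97 is attained by the insertion kernel in the iterated limit (THEORY-2.md v3.9 §4 C9′); at
  FIXED `L` floor and ceiling differ by the volume term (conjecture C9″, not decided here).
Elementary given items 97, 100, 104b and Mathlib's `tendsto_rpow_mul_exp_neg_mul_atTop_nhds_zero`;
one `def` (`boxTunnelProb`).
-/

noncomputable section

namespace Summit.Ventures.LatticeQCDFlow.Theory2.Lattice.Flux

open MeasureTheory ProbabilityTheory Filter Topology Real
open scoped ENNReal
open Literature.MathematicalPhysics.QuantumFieldTheory Literature.MathematicalPhysics.QuantumLattice
open Summit.Ventures.LatticeQCDFlow.Exactness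
open Summit.Ventures.LatticeQCDFlow.Theory2.HaarConv

variable {l : ℕ}

/-- The per-step tunnelling probability of the block-insertion kernel in equilibrium,
`P_{β,l,L} = (μ_{β,L} ⊗ K_box){Q ≠ Q'}`, as a real number. [new work] -/
def boxTunnelProb (β : ℝ) (l L : ℕ) [NeZero L] : ℝ :=
  ((wilsonMeasure (d := 2) (L := L) u1Rep β) ⊗ₘ boxInsertionMH (L := L) β l).real
    {q | topCharge (0 : Site 2 L) 0 1 q.1 ≠ topCharge (0 : Site 2 L) 0 1 q.2}

/-- `N = (l+1)² − 4 = (l−1)(l+3)` in real numbers (`2 ≤ l`). [folklore] -/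
theorem natCast_boxN (hl : 2 ≤ l) :
    ((((l + 1) * (l + 1) - 4 : ℕ)) : ℝ) = ((l : ℝ) - 1) * ((l : ℝ) + 3) := by
  have h4 : 4 ≤ (l + 1) * (l + 1) := by nlinarith
  rw [Nat.cast_sub h4]
  push_cast
  ring

/-- `θ = α_l/2 = π/N`. [folklore] -/
theorem boxAlpha_half_eq (hl : 2 ≤ l) :
    boxAlpha l / 2 = π / ((((l + 1) * (l + 1) - 4 : ℕ)) : ℝ) := by
  rw [natCast_boxN hl]
  unfold boxAlpha
  ring

/-- `0 < θ`, `3θ < π`, `0 < cos θ`, `0 < 1 + cos 3θ`, `0 ≤ sin θ ≤ 1` for `θ = α_l/2`, `2 ≤ l`.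
[folklore] -/
theorem boxAlpha_half_facts (hl : 2 ≤ l) :
    0 < boxAlpha l / 2 ∧ 3 * (boxAlpha l / 2) < π ∧ 0 < Real.cos (boxAlpha l / 2) ∧
      0 < 1 + Real.cos (3 * (boxAlpha l / 2)) ∧ 0 ≤ Real.sin (boxAlpha l / 2) := by
  have h2 : (2 : ℝ) ≤ l := by exact_mod_cast hl
  have hD : (5 : ℝ) ≤ ((l : ℝ) - 1) * ((l : ℝ) + 3) := by nlinarith
  have hDpos : 0 < ((l : ℝ) - 1) * ((l : ℝ) + 3) := by linarith
  have hθ : 0 < boxAlpha l / 2 := by have := boxAlpha_pos hl; positivity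
  have h3 : 3 * (boxAlpha l / 2) < π := by
    rw [show 3 * (boxAlpha l / 2) = 3 * π / (((l : ℝ) - 1) * ((l : ℝ) + 3)) by unfold boxAlpha; ring,
      div_lt_iff₀ hDpos]
    nlinarith [Real.pi_pos]
  have hcos : 0 < Real.cos (boxAlpha l / 2) :=
    Real.cos_pos_of_mem_Ioo ⟨by linarith, by linarith [Real.pi_pos]⟩
  have hsin3 : 0 < Real.sin (3 * (boxAlpha l / 2)) :=
    Real.sin_pos_of_pos_of_lt_pi (by positivity) h3
  have hc : 0 < 1 + Real.cos (3 * (boxAlpha l / 2)) := by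
    by_contra h
    push Not at h
    nlinarith [Real.sin_sq_add_cos_sq (3 * (boxAlpha l / 2)), Real.neg_one_le_cos (3 * (boxAlpha l / 2))]
  exact ⟨hθ, h3, hcos, hc, Real.sin_nonneg_of_nonneg_of_le_pi hθ.le (by linarith)⟩

/-! ## §2 The floor rate at fixed volume -/

section FixedVolume

variable {L : ℕ} [NeZero L]

/-- **FLOOR RATE AT FIXED VOLUME** (`2 ≤ l`, `l + 1 ≤ L`, any parity of `L`, `ε > 0`;
`N = (l+1)² − 4`, `θ = α_l/2`, `M = L² − N`): eventually in `β`,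
`e^{−β(N(1 − cos θ) + M(1 − cos(π/(M−1))) + ε)} ≤ P_{β,l,L}` — item 104b's sharp floor with
`η = ε/2`, `λ = κη/N`. [new work] -/
theorem u1_boxInsertion_rate_floor (hl : 2 ≤ l) (hlL : l + 1 ≤ L) {ε : ℝ} (hε : 0 < ε) :
    ∀ᶠ β : ℝ in atTop,
      Real.exp (-(β * ((((l + 1) * (l + 1) - 4 : ℕ) : ℝ) * (1 - Real.cos (boxAlpha l / 2)) +
        ((L ^ 2 - ((l + 1) * (l + 1) - 4) : ℕ) : ℝ) *
          (1 - Real.cos (π / ((L ^ 2 - ((l + 1) * (l + 1) - 4) - 1 : ℕ) : ℝ))) + ε))) ≤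
      boxTunnelProb β l L := by
  obtain ⟨hθ, h3, hcos, hc, hsin⟩ := boxAlpha_half_facts hl
  have hsin1 : Real.sin (boxAlpha l / 2) ≤ 1 := Real.sin_le_one _
  have hN5 : 5 ≤ (l + 1) * (l + 1) - 4 := by
    have : 9 ≤ (l + 1) * (l + 1) := by nlinarith
    omega
  have hNpos : (0 : ℝ) < (((l + 1) * (l + 1) - 4 : ℕ) : ℝ) := by
    have : (5 : ℝ) ≤ (((l + 1) * (l + 1) - 4 : ℕ) : ℝ) := by exact_mod_cast hN5
    linarith
  have E0 : ∀ᶠ β : ℝ in atTop, (0 : ℝ) ≤ β := eventually_ge_atTop 0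
  have E1 : ∀ᶠ β : ℝ in atTop, 1 / Real.cos (boxAlpha l / 2) ≤ β := eventually_ge_atTop _
  have E2 : ∀ᶠ β : ℝ in atTop,
      2 * (((l + 1) * (l + 1) - 4 : ℕ) : ℝ) * Real.log 8 /
        (Real.cos (boxAlpha l / 2) * (ε / 2) ^ 2) ≤ β := eventually_ge_atTop _
  have E3 : ∀ᶠ β : ℝ in atTop, 2 * Real.log 8 / ε ≤ β := eventually_ge_atTop _
  have E4 : ∀ᶠ β : ℝ in atTop,
      (((l + 1) * (l + 1) - 4 : ℕ) : ℝ) * (π * Real.exp (1 / 2)) *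
        ((β * Real.cos (boxAlpha l / 2)) ^ (1 / 2 : ℝ) *
          Real.exp (-(1 + Real.cos (3 * (boxAlpha l / 2))) * (β * Real.cos (boxAlpha l / 2)))) <
        4⁻¹ := by
    have ht : Tendsto (fun β : ℝ => β * Real.cos (boxAlpha l / 2)) atTop atTop :=
      tendsto_id.atTop_mul_const hcos
    have h0 : Tendsto (fun β : ℝ => (((l + 1) * (l + 1) - 4 : ℕ) : ℝ) * (π * Real.exp (1 / 2)) *
        ((β * Real.cos (boxAlpha l / 2)) ^ (1 / 2 : ℝ) *
          Real.exp (-(1 + Real.cos (3 * (boxAlpha l / 2))) * (β * Real.cos (boxAlpha l / 2)))))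
        atTop (𝓝 ((((l + 1) * (l + 1) - 4 : ℕ) : ℝ) * (π * Real.exp (1 / 2)) * 0)) :=
      ((tendsto_rpow_mul_exp_neg_mul_atTop_nhds_zero (1 / 2) _ hc).comp ht).const_mul _
    rw [mul_zero] at h0
    exact h0.eventually (gt_mem_nhds (by norm_num))
  filter_upwards [E0, E1, E2, E3, E4] with β hβ0 hβ1 hβ2 hβ3 hβ4
  have hκ : 1 ≤ β * Real.cos (boxAlpha l / 2) := by rwa [div_le_iff₀ hcos] at hβ1
  have hlam0 : 0 ≤ β * Real.cos (boxAlpha l / 2) * (ε / 2) / (((l + 1) * (l + 1) - 4 : ℕ) : ℝ) :=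
    div_nonneg (mul_nonneg (mul_nonneg hβ0 hcos.le) (by positivity)) (Nat.cast_nonneg _)
  have H := u1_boxInsertion_sharp_floor_real (η := ε / 2) hl hlL hβ0 hκ hlam0
  -- abbreviations (rewritten everywhere, `H` included)
  set N : ℕ := (l + 1) * (l + 1) - 4 with hN
  set θ : ℝ := boxAlpha l / 2 with hθdef
  set M : ℕ := L ^ 2 - N with hM
  set m₁ : ℝ := 1 - Real.cos (π / ((M - 1 : ℕ) : ℝ)) with hm₁
  set κ : ℝ := β * Real.cos θ with hκdef
  set lam : ℝ := κ * (ε / 2) / (N : ℝ) with hlam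
  have hκpos : 0 < κ := by linarith
  have hκne : κ ≠ 0 := hκpos.ne'
  have hNne : (N : ℝ) ≠ 0 := hNpos.ne'
  -- the Chernoff term `T₂ ≤ ¼`
  have hT2 : 2 * Real.exp (-(lam * (ε / 2)) + (N : ℝ) * (lam ^ 2 / (2 * κ))) ≤ 4⁻¹ := by
    have hexp : -(lam * (ε / 2)) + (N : ℝ) * (lam ^ 2 / (2 * κ)) = -(κ * (ε / 2) ^ 2 / (2 * N)) := by
      rw [hlam]
      field_simp
      ring
    rw [hexp]
    have h8 : Real.exp (-(κ * (ε / 2) ^ 2 / (2 * N))) ≤ 8⁻¹ := by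
      rw [← Real.exp_log (by norm_num : (0 : ℝ) < 8), ← Real.exp_neg]
      apply Real.exp_le_exp.2
      have h1 : 2 * (N : ℝ) * Real.log 8 ≤ β * (Real.cos θ * (ε / 2) ^ 2) :=
        (div_le_iff₀ (by positivity)).1 hβ2
      have h2 : Real.log 8 ≤ κ * (ε / 2) ^ 2 / (2 * N) := by
        rw [le_div_iff₀ (by positivity), hκdef]
        linarith
      linarith
    linarith
  -- the bad-arc term `T₃ ≤ ¼`
  have hT3 : (N : ℝ) * (π * Real.exp (1 / 2) * Real.sqrt κ) *
      Real.exp (-(κ * (1 + Real.cos (3 * θ)))) ≤ 4⁻¹ := by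
    have heq : Real.exp (-(κ * (1 + Real.cos (3 * θ)))) =
        Real.exp (-(1 + Real.cos (3 * θ)) * κ) := by
      congr 1; ring
    rw [Real.sqrt_eq_rpow, heq]
    linarith
  have hB : (1 : ℝ) / 2 ≤ 1 - 2 * Real.exp (-(lam * (ε / 2)) + (N : ℝ) * (lam ^ 2 / (2 * κ))) -
      (N : ℝ) * (π * Real.exp (1 / 2) * Real.sqrt κ) * Real.exp (-(κ * (1 + Real.cos (3 * θ)))) := by
    linarith
  have hρA : 0 ≤ 4⁻¹ * Real.exp (-(β * ((M : ℝ) * m₁))) *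
      Real.exp (-((N : ℝ) * (β - β * Real.cos θ) + β * Real.sin θ * (ε / 2))) := by positivity
  have hP : 4⁻¹ * Real.exp (-(β * ((M : ℝ) * m₁))) *
      Real.exp (-((N : ℝ) * (β - β * Real.cos θ) + β * Real.sin θ * (ε / 2))) * (1 / 2) ≤
      boxTunnelProb β l L :=
    le_trans (mul_le_mul_of_nonneg_left hB hρA) H
  refine le_trans ?_ hP
  -- compare exponents: `¼·½ = e^{−log 8}`, `β sin θ·ε/2 ≤ βε/2`, `log 8 ≤ βε/2`
  have h8 : (4 : ℝ)⁻¹ * (1 / 2) = Real.exp (-Real.log 8) := by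
    rw [Real.exp_neg, Real.exp_log (by norm_num)]; norm_num
  rw [show 4⁻¹ * Real.exp (-(β * ((M : ℝ) * m₁))) *
      Real.exp (-((N : ℝ) * (β - β * Real.cos θ) + β * Real.sin θ * (ε / 2))) * (1 / 2) =
      Real.exp (-(β * ((M : ℝ) * m₁))) *
        Real.exp (-((N : ℝ) * (β - β * Real.cos θ) + β * Real.sin θ * (ε / 2))) * (4⁻¹ * (1 / 2)) by
      ring, h8, ← Real.exp_add, ← Real.exp_add]
  apply Real.exp_le_exp.2
  have h1 := mul_le_mul_of_nonneg_left hsin1 (mul_nonneg hβ0 (half_pos hε).le)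
  have h2 := (div_le_iff₀ hε).1 hβ3
  nlinarith

/-! ## §3 The ceiling rate at fixed (even) volume -/

/-- **CEILING RATE AT FIXED VOLUME** (`2 ≤ l`, `l + 1 ≤ L`, `L` even, `ε > 0`): eventually in `β`,
`P_{β,l,L} ≤ e^{−β(N(1 − cos θ) − ε)}` — item 97's action-currency law for this exact,
block-local kernel (`z₁(β)^{n+N}·P ≤ 2e^{−βN(1−cos(π/N))}`, `n = ⌈N/2⌉`) and `z₁(β) ≥ e^{−1/2}/(π√β)`.
[new work] -/
theorem u1_boxInsertion_rate_ceiling (hl : 2 ≤ l) (hlL : l + 1 ≤ L) (hLe : Even L) {ε : ℝ}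
    (hε : 0 < ε) :
    ∀ᶠ β : ℝ in atTop,
      boxTunnelProb β l L ≤
        Real.exp (-(β * ((((l + 1) * (l + 1) - 4 : ℕ) : ℝ) * (1 - Real.cos (boxAlpha l / 2)) - ε))) := by
  have h4 : 4 ≤ (l + 1) * (l + 1) := by nlinarith
  have hNL : (l + 1) * (l + 1) ≤ L ^ 2 := by rw [sq]; exact Nat.mul_le_mul hlL hlL
  set N : ℕ := (l + 1) * (l + 1) - 4 with hN
  set n : ℕ := (N + 1) / 2 with hn
  have hn1 : N ≤ 2 * n := by omega
  have hn2 : 2 * n + 2 ≤ L ^ 2 := by omega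
  set c : ℝ := (N : ℝ) * (1 - Real.cos (boxAlpha l / 2)) with hc
  have hc' : ((l : ℝ) - 1) * ((l : ℝ) + 3) *
      (1 - Real.cos (π / (((l : ℝ) - 1) * ((l : ℝ) + 3)))) = c := by
    have e1 : (N : ℝ) = ((l : ℝ) - 1) * ((l : ℝ) + 3) := by rw [hN]; exact natCast_boxN hl
    have e2 : boxAlpha l / 2 = π / (((l : ℝ) - 1) * ((l : ℝ) + 3)) := by unfold boxAlpha; ring
    rw [hc, e1, e2]
  have E0 : ∀ᶠ β : ℝ in atTop, (1 : ℝ) ≤ β := eventually_ge_atTop 1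
  have E1 : ∀ᶠ β : ℝ in atTop,
      2 * Real.exp (n + N : ℕ) * (π ^ 2) ^ (n + N) * (β ^ ((n + N : ℕ) : ℝ) * Real.exp (-ε * β)) <
        1 := by
    have h0 := (tendsto_rpow_mul_exp_neg_mul_atTop_nhds_zero ((n + N : ℕ) : ℝ) ε hε).const_mul
      (2 * Real.exp (n + N : ℕ) * (π ^ 2) ^ (n + N))
    rw [mul_zero] at h0
    exact h0.eventually (gt_mem_nhds zero_lt_one)
  filter_upwards [E0, E1] with β hβ1 hβE
  have hβ0 : (0 : ℝ) ≤ β := by linarith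
  haveI : IsProbabilityMeasure (wilsonMeasure (d := 2) (L := L) u1Rep β) :=
    isProbabilityMeasure_wilsonMeasure u1Rep continuous_u1Rep β
  have H := u1_tunnelling_boxLinks_action (by omega) hLe hβ0 hl hlL n hn1 hn2
    (boxInsertionMH (L := L) β l) (boxInsertionMH_invariant β l) (ae_boxInsertionMH_eq_off hl hlL β _)
  rw [hc'] at H
  have hzt := z1_u1_ne_top hβ0
  set z : ℝ := (z1 u1Rep β).toReal with hz
  have key : z ^ (n + N) * boxTunnelProb β l L ≤ 2 * Real.exp (-(β * c)) := by
    have h1 := (ENNReal.toReal_le_toReal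
      (ENNReal.mul_ne_top (ENNReal.pow_ne_top hzt) (measure_ne_top _ _))
      (ENNReal.mul_ne_top ENNReal.ofNat_ne_top ENNReal.ofReal_ne_top)).mpr H
    rw [ENNReal.toReal_mul, ENNReal.toReal_pow, ENNReal.toReal_mul,
      ENNReal.toReal_ofReal (Real.exp_pos _).le] at h1
    simpa [boxTunnelProb, measureReal_def] using h1
  have hz2 : Real.exp (-1) / (π ^ 2 * β) ≤ z ^ 2 := exp_neg_one_div_le_z1_toReal_sq hβ1
  have hz0 : 0 ≤ z := ENNReal.toReal_nonneg
  have hz1 : z ≤ 1 := by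
    simpa using ENNReal.toReal_mono ENNReal.one_ne_top (z1_u1_le_one hβ0)
  have hzk : (Real.exp (-1) / (π ^ 2 * β)) ^ (n + N) ≤ z ^ (n + N) := by
    calc (Real.exp (-1) / (π ^ 2 * β)) ^ (n + N) ≤ (z ^ 2) ^ (n + N) :=
          pow_le_pow_left₀ (by positivity) hz2 _
      _ = z ^ (n + N) * z ^ (n + N) := by rw [sq, mul_pow]
      _ ≤ z ^ (n + N) * 1 :=
          mul_le_mul_of_nonneg_left (pow_le_one₀ hz0 hz1) (pow_nonneg hz0 _)
      _ = z ^ (n + N) := mul_one _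
  have hP : boxTunnelProb β l L ≤
      2 * Real.exp (-(β * c)) * ((π ^ 2 * β) / Real.exp (-1)) ^ (n + N) := by
    have h1 : (Real.exp (-1) / (π ^ 2 * β)) ^ (n + N) * boxTunnelProb β l L ≤
        2 * Real.exp (-(β * c)) :=
      le_trans (mul_le_mul_of_nonneg_right hzk measureReal_nonneg) key
    rw [show ((π ^ 2 * β) / Real.exp (-1)) ^ (n + N) = ((Real.exp (-1) / (π ^ 2 * β)) ^ (n + N))⁻¹ by
      rw [← inv_pow, inv_div], ← div_eq_mul_inv, le_div_iff₀ (by positivity)]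
    linarith
  refine le_trans hP ?_
  have hek : ((π ^ 2 * β) / Real.exp (-1)) ^ (n + N) =
      Real.exp (n + N : ℕ) * (π ^ 2) ^ (n + N) * β ^ ((n + N : ℕ) : ℝ) := by
    rw [Real.exp_neg, div_eq_mul_inv, inv_inv, mul_pow, mul_pow, ← Real.exp_nat_mul, mul_one,
      Real.rpow_natCast]
    ring
  rw [hek, show Real.exp (-(β * (c - ε))) = Real.exp (-(β * c)) * Real.exp (ε * β) by
    rw [← Real.exp_add]; congr 1; ring]
  have hX : 2 * (Real.exp (n + N : ℕ) * (π ^ 2) ^ (n + N) * β ^ ((n + N : ℕ) : ℝ)) ≤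
      Real.exp (ε * β) := by
    have h := mul_lt_mul_of_pos_right hβE (Real.exp_pos (ε * β))
    rw [one_mul, show 2 * Real.exp (n + N : ℕ) * (π ^ 2) ^ (n + N) *
        (β ^ ((n + N : ℕ) : ℝ) * Real.exp (-ε * β)) * Real.exp (ε * β) =
        2 * (Real.exp (n + N : ℕ) * (π ^ 2) ^ (n + N) * β ^ ((n + N : ℕ) : ℝ)) *
          (Real.exp (-ε * β) * Real.exp (ε * β)) by ring, ← Real.exp_add,
      show -ε * β + ε * β = 0 by ring, Real.exp_zero, mul_one] at h
    exact h.le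
  calc 2 * Real.exp (-(β * c)) * (Real.exp (n + N : ℕ) * (π ^ 2) ^ (n + N) * β ^ ((n + N : ℕ) : ℝ))
      = Real.exp (-(β * c)) *
          (2 * (Real.exp (n + N : ℕ) * (π ^ 2) ^ (n + N) * β ^ ((n + N : ℕ) : ℝ))) := by ring
    _ ≤ Real.exp (-(β * c)) * Real.exp (ε * β) :=
        mul_le_mul_of_nonneg_left hX (Real.exp_pos _).le

end FixedVolume

/-! ## §4 The iterated limit `L → ∞` after `β → ∞` -/

/-- The volume term of the floor rate is small: `M(1 − cos(π/(M−1))) ≤ π²/(M−1)` for `M ≥ 2`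
(`1 − cos x ≤ x²/2`). [folklore] -/
theorem volumeTerm_le {M : ℕ} (hM : 2 ≤ M) :
    (M : ℝ) * (1 - Real.cos (π / ((M - 1 : ℕ) : ℝ))) ≤ π ^ 2 / ((M : ℝ) - 1) := by
  have hM1 : (((M - 1 : ℕ)) : ℝ) = (M : ℝ) - 1 := by
    rw [Nat.cast_sub (by omega)]; simp
  rw [hM1]
  have hMr : (2 : ℝ) ≤ M := by exact_mod_cast hM
  have hM1pos : 0 < (M : ℝ) - 1 := by linarith
  have hcos : 1 - Real.cos (π / ((M : ℝ) - 1)) ≤ (π / ((M : ℝ) - 1)) ^ 2 / 2 := by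
    linarith [Real.one_sub_sq_div_two_le_cos (x := π / ((M : ℝ) - 1))]
  calc (M : ℝ) * (1 - Real.cos (π / ((M : ℝ) - 1)))
      ≤ (M : ℝ) * ((π / ((M : ℝ) - 1)) ^ 2 / 2) := mul_le_mul_of_nonneg_left hcos (by positivity)
    _ = (M : ℝ) / (2 * ((M : ℝ) - 1)) * (π ^ 2 / ((M : ℝ) - 1)) := by
        field_simp
    _ ≤ 1 * (π ^ 2 / ((M : ℝ) - 1)) := by
        refine mul_le_mul_of_nonneg_right ?_ (by positivity)
        rw [div_le_one (by positivity)]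
        linarith
    _ = π ^ 2 / ((M : ℝ) - 1) := one_mul _

/-- **FLOOR RATE IN THE ITERATED LIMIT** (`2 ≤ l`, `ε > 0`): there is `L₀` such that for every
`L ≥ L₀` (any parity), eventually in `β`, `e^{−β(N(1 − cos(π/N)) + ε)} ≤ P_{β,l,L}`. [new work] -/
theorem u1_boxInsertion_rate_floor_largeVolume (hl : 2 ≤ l) {ε : ℝ} (hε : 0 < ε) :
    ∃ L₀ : ℕ, ∀ (L : ℕ) [NeZero L], L₀ ≤ L → ∀ᶠ β : ℝ in atTop,
      Real.exp (-(β * ((((l + 1) * (l + 1) - 4 : ℕ) : ℝ) * (1 - Real.cos (boxAlpha l / 2)) + ε))) ≤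
        boxTunnelProb β l L := by
  obtain ⟨T, hT⟩ := exists_nat_ge (2 * π ^ 2 / ε)
  refine ⟨(l + 1) * (l + 1) + T + (l + 1), fun L _ hL => ?_⟩
  have hlL : l + 1 ≤ L := by omega
  have hLL : L ≤ L ^ 2 := by rw [sq]; exact Nat.le_mul_self L
  set N : ℕ := (l + 1) * (l + 1) - 4 with hN
  set M : ℕ := L ^ 2 - N with hM
  have hM2 : 2 + T ≤ M := by omega
  have hvol : (M : ℝ) * (1 - Real.cos (π / ((M - 1 : ℕ) : ℝ))) ≤ ε / 2 := by
    refine le_trans (volumeTerm_le (by omega)) ?_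
    have hMr : (2 : ℝ) + T ≤ M := by exact_mod_cast hM2
    have hM1pos : 0 < (M : ℝ) - 1 := by linarith [(Nat.cast_nonneg T : (0 : ℝ) ≤ T)]
    rw [div_le_iff₀ hM1pos]
    have h1 : 2 * π ^ 2 / ε ≤ (M : ℝ) - 1 := by linarith
    have h2 := (div_le_iff₀ hε).1 h1
    nlinarith
  have hA := u1_boxInsertion_rate_floor hl hlL (half_pos hε)
  filter_upwards [hA, eventually_ge_atTop (0 : ℝ)] with β hβ hβ0
  refine le_trans (Real.exp_le_exp.2 ?_) hβ
  have := mul_le_mul_of_nonneg_left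
    (show (N : ℝ) * (1 - Real.cos (boxAlpha l / 2)) +
        (M : ℝ) * (1 - Real.cos (π / ((M - 1 : ℕ) : ℝ))) + ε / 2 ≤
        (N : ℝ) * (1 - Real.cos (boxAlpha l / 2)) + ε by linarith) hβ0
  linarith

/-- **THE SHARP RATE (conjecture C9′ of THEORY-2.md, typed)** (`2 ≤ l`, `N = (l+1)² − 4`,
`θ = α_l/2 = π/N`): for every `ε > 0` there is `L₀` such that for every EVEN `L ≥ L₀`, eventually
in `β`, `e^{−β(N(1 − cos θ) + ε)} ≤ P_{β,l,L} ≤ e^{−β(N(1 − cos θ) − ε)}`: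
`lim_{L → ∞, L even} lim_{β → ∞} −(1/β) log P_{β,l,L} = N(1 − cos(π/N))` — the necessity rate of
item 97 is attained by gen-19's block-insertion kernel in the iterated limit. [new work] -/
theorem u1_boxInsertion_sharp_rate (hl : 2 ≤ l) {ε : ℝ} (hε : 0 < ε) :
    ∃ L₀ : ℕ, ∀ (L : ℕ) [NeZero L], L₀ ≤ L → Even L → ∀ᶠ β : ℝ in atTop,
      Real.exp (-(β * ((((l + 1) * (l + 1) - 4 : ℕ) : ℝ) * (1 - Real.cos (boxAlpha l / 2)) + ε))) ≤
          boxTunnelProb β l L ∧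
        boxTunnelProb β l L ≤
          Real.exp (-(β * ((((l + 1) * (l + 1) - 4 : ℕ) : ℝ) * (1 - Real.cos (boxAlpha l / 2)) - ε))) := by
  obtain ⟨L₀, hL₀⟩ := u1_boxInsertion_rate_floor_largeVolume hl hε
  refine ⟨max L₀ (l + 1), fun L _ hL hLe => ?_⟩
  have h1 := hL₀ L (le_trans (le_max_left _ _) hL)
  have h2 := u1_boxInsertion_rate_ceiling hl (le_trans (le_max_right _ _) hL) hLe hε
  filter_upwards [h1, h2] with β hβ1 hβ2
  exact ⟨hβ1, hβ2⟩

/-- The same with the rate displayed as `N(1 − cos(π/N))`. [new work] -/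
theorem u1_boxInsertion_sharp_rate' (hl : 2 ≤ l) {ε : ℝ} (hε : 0 < ε) :
    ∃ L₀ : ℕ, ∀ (L : ℕ) [NeZero L], L₀ ≤ L → Even L → ∀ᶠ β : ℝ in atTop,
      Real.exp (-(β * ((((l + 1) * (l + 1) - 4 : ℕ) : ℝ) *
          (1 - Real.cos (π / (((l + 1) * (l + 1) - 4 : ℕ) : ℝ))) + ε))) ≤ boxTunnelProb β l L ∧
        boxTunnelProb β l L ≤ Real.exp (-(β * ((((l + 1) * (l + 1) - 4 : ℕ) : ℝ) *
          (1 - Real.cos (π / (((l + 1) * (l + 1) - 4 : ℕ) : ℝ))) - ε))) := by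
  rw [← boxAlpha_half_eq hl]
  exact u1_boxInsertion_sharp_rate hl hε

end Summit.Ventures.LatticeQCDFlow.Theory2.Lattice.Flux

end
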